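import Literature.NumberTheory.EllipticCurves.PAdicLFunctionTameIntegralityAtTwoSharedPrimesProofs
import Literature.NumberTheory.EllipticCurves.PAdicLFunctionDistributionHoldsProofs
import Literature.NumberTheory.EllipticCurves.PAdicBSDSplitMultiplicativeProofs
import Literature.NumberTheory.EllipticCurves.PAdicLFunctionTame
import HarnessLib

/-!
# Route `AlignedTransportAtTwo`, crux C1 `MainConjectureTransportAlignedAtTwo` (stmt-BirchSwinnertonDyer-22296), line `birth` —
# the BOTH-ADDITIVE twist leg, part 1 (SYMBOLS): cusp classes `c/ℓ` of `X₀(N)` for `ℓ² ∣ N`, the `U_ℓ`-relation with `a_ℓ = 0`,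
# and the vanishing of the class representatives in character sums over a tame level `u = ℓ·m`

HONEST FRAMING (cell `bsd-f1-sign2`, lead seat `bsd-line-att-p1` g8). BSD is NOT proved; C1 is NOT closed. THEOREMS ONLY about modular
symbols of weight-2 cusp forms (no curve, no `def`, nothing asserted); `--supports stmt-BirchSwinnertonDyer-22296 --as helper`.

WHY (the open content (b) of skeleton v20: twist pairs with a prime `ℓ` of `d` at which BOTH curves are additive). The tree's tame
`2`-adic machinery bounds the Mazur–Swinnerton-Dyer measure `μ_{f,α,m}` cell by cell through Manin's trick: a tame fraction `x = c/(2ⁿm)`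
whose denominator meets `N` in `g` with `gcd(g, N/g) = 1` is `Γ₀(N)`-equivalent to `1/g` (`modularSymbol_sub_inv_gcd_mem_periodLattice`),
so `[x]⁺ = [1/g]⁺ + k/2`. When `ℓ² ∣ N` and `ℓ ∥ den x` there are `ℓ − 1` classes `c/ℓ` and the class of `x = A/(ℓC')` is
`c ≡ A·C' (mod ℓ)` (§1, Cremona's criterion with an explicit matrix); the representatives `[c/ℓ]⁺` are not controlled individually,
but (§3) their sum over `c ∈ (ℤ/ℓ)ˣ` is `−[0]⁺` by the `U_ℓ`-relation with `a_ℓ = 0` (additive `ℓ`), and (§4) in a character sum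
over `b mod ℓm` weighted by a character NON-TRIVIAL on the units `≡ 1 (mod ℓ)` they CANCEL (shift by such a unit `h₀` with
`χ(h₀) ≠ 1`). Part 2 turns this into `χ`-isotypic bounds for `μ_{f,α,ℓm}` and the congruence `L₂(f,α,χ) ≡ L₂(f,α,𝟙_{ℓm}) (mod 2Λ)`.

* §1 `modularSymbol_div_sub_div_mem_periodLattice_of_sq_dvd` — `N = ℓ²M`: `{∞, A/(ℓC')} − {∞, r/ℓ} ∈ Λ_f` whenever
  `gcd(C', ℓMA) = 1` and `r ≡ A·C' (mod ℓ)` (explicit `γ ∈ Γ₀(N)`, Manin's relation `modularSymbol_gamma0_smul_holds`).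
* §2 `exists_ratPlusSymbol_eq_add_div_two_of_sub_mem` — `{∞,x} − {∞,y} ∈ Λ_f ⟹ [x]⁺ = [y]⁺ + k/2` (real coefficients; junk-safe).
* §3 `sum_ratPlusSymbol_add_div_eq_zero`, `sum_ratPlusSymbol_intCast_mul_div_eq_neg` — `Σ_{j mod ℓ} [(x+j)/ℓ]⁺ = 0` and
  `Σ_{c mod ℓ, c ≠ 0} [c·t/ℓ]⁺ = −[0]⁺` (`t` prime to `ℓ`) for a rational newform with `a_ℓ = 0`, `ℓ ∣ N`.
* §4 `sum_mul_eq_zero_of_shift` — the shift lemma: `Σ_b χ(b)F(b) = 0` if `F(b·h₀) = F(b)` for all `b`, `χ(h₀) ≠ 1`.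

References: [Manin1972] Prop. 1.4, Thm. 1.6; [CremonaAlgorithms1997] §2.2 Lemma 2.2.3, §2.8; [MazurTateTeitelbaum1986Invent] §I.4 (4.2),
§I.8, §I.10; [Matsuno2000] §2, Lemma 3.2.
-/

set_option autoImplicit false
set_option linter.dupNamespace false

noncomputable section

open scoped Classical MatrixGroups ModularForm

open CongruenceSubgroup Literature.NumberTheory.EllipticCurves Literature.NumberTheory.EllipticCurves.ModularForms

namespace Summit.BirchSwinnertonDyer.BirchSwinnertonDyer.Theorems.AlignedTransportAtTwoBothAddSymbol

variable {N : ℕ} [NeZero N] (f : CuspForm (Gamma0 N) 2)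

/-! ## §1 The cusp classes `c/ℓ` of `X₀(N)` when `ℓ² ∣ N` -/

/-- **Cusp classes for `ℓ² ∣ N`** (`N = ℓ²·M`): the cusp `A/(ℓ·C')` with `gcd(C', ℓ·M·A) = 1` is `Γ₀(N)`-equivalent to `r/ℓ`
for every `r ≡ A·C' (mod ℓ)`, i.e. `{∞, A/(ℓC')}_f − {∞, r/ℓ}_f ∈ Λ_f`. With `αC' − κℓMA = 1` (Bézout) and `r = AC' + ℓt` the matrix
`γ = (α, −κMA² − αt; Nκ, C' − ℓMκr) ∈ Γ₀(N)` has determinant `(1 − ℓMκA)(αC' − κℓMA) + ℓMκA = 1` and `γ(r/ℓ) = A/(ℓC')`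
(numerator `αr + βℓ = A(αC' − κℓMA) = A`, denominator `Nκr + δℓ = ℓC'`); Manin's relation `{∞, γx} = {∞, γ∞} + {∞, x}`
(`modularSymbol_gamma0_smul_holds`) exhibits the difference as the period `{∞, γ∞}_f`. This is Cremona's cusp-equivalence criterion
(Lemma 2.2.3) in the case `gcd(den, N) = ℓ`, `ℓ ∣ N/ℓ`, where the class is the residue `A·C' mod ℓ` (there are `ℓ − 1` classes);
the tree's `modularSymbol_div_sub_inv_mem_periodLattice` is the complementary case `gcd(ℓ, N/ℓ) = 1` (one class, `1/ℓ`).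
[cite: CremonaAlgorithms1997, §2.2 Lemma 2.2.3] [cite: Manin1972, Prop. 1.4 and Thm. 1.6] -/
theorem modularSymbol_div_sub_div_mem_periodLattice_of_sq_dvd {ℓ M A C' r t : ℤ} (hN : (N : ℤ) = ℓ ^ 2 * M)
    (hℓ : ℓ ≠ 0) (hC' : C' ≠ 0) (hcop : IsCoprime C' (ℓ * M * A)) (hr : r = A * C' + ℓ * t) :
    modularSymbol f ((A : ℚ) / (ℓ * C')) - modularSymbol f ((r : ℚ) / ℓ) ∈ periodLattice f := by
  obtain ⟨α, κ', h⟩ := hcop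
  -- `α C' − κ ℓ M A = 1` with `κ = −κ'`
  set κ : ℤ := -κ' with hκ
  have h1 : α * C' - κ * ℓ * M * A = 1 := by rw [hκ]; linear_combination h
  set β : ℤ := -κ * M * A ^ 2 - α * t with hβ
  set δ : ℤ := C' - ℓ * M * κ * r with hδ
  let γ : SL(2, ℤ) := ⟨!![α, β; (N : ℤ) * κ, δ], by
    rw [Matrix.det_fin_two_of, hδ, hβ, hN, hr]
    linear_combination (1 - ℓ * M * κ * A) * h1⟩
  have hγ0 : γ ∈ Gamma0 N := by
    rw [Gamma0_mem]
    show ((((N : ℤ) * κ : ℤ)) : ZMod N) = 0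
    push_cast
    rw [ZMod.natCast_self, zero_mul]
  have hℓQ : (ℓ : ℚ) ≠ 0 := by exact_mod_cast hℓ
  have hC'Q : (C' : ℚ) ≠ 0 := by exact_mod_cast hC'
  have e00 : (γ 0 0 : ℤ) = α := rfl
  have e01 : (γ 0 1 : ℤ) = β := rfl
  have e10 : (γ 1 0 : ℤ) = (N : ℤ) * κ := rfl
  have e11 : (γ 1 1 : ℤ) = δ := rfl
  have hnumZ : α * r + β * ℓ = A := by rw [hβ, hr]; linear_combination A * h1
  have hdenZ : (N : ℤ) * κ * r + δ * ℓ = ℓ * C' := by rw [hδ, hN]; ring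
  have hnum : ((γ 0 0 : ℤ) : ℚ) * ((r : ℚ) / ℓ) + ((γ 0 1 : ℤ) : ℚ) = (A : ℚ) / ℓ := by
    rw [e00, e01]
    have : (α : ℚ) * r + β * ℓ = A := by exact_mod_cast hnumZ
    field_simp
    linear_combination this
  have hden : ((γ 1 0 : ℤ) : ℚ) * ((r : ℚ) / ℓ) + ((γ 1 1 : ℤ) : ℚ) = (C' : ℚ) := by
    rw [e10, e11]
    have : ((N : ℤ) : ℚ) * κ * r + δ * ℓ = ℓ * C' := by exact_mod_cast hdenZ
    push_cast at this ⊢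
    field_simp
    linear_combination this
  have hne : ((γ 1 0 : ℤ) : ℚ) * ((r : ℚ) / ℓ) + ((γ 1 1 : ℤ) : ℚ) ≠ 0 := by rw [hden]; exact hC'Q
  have key := modularSymbol_gamma0_smul_holds f ⟨γ, hγ0⟩ ((r : ℚ) / ℓ) hne
  have hquot : (((γ 0 0 : ℤ) : ℚ) * ((r : ℚ) / ℓ) + ((γ 0 1 : ℤ) : ℚ)) /
      (((γ 1 0 : ℤ) : ℚ) * ((r : ℚ) / ℓ) + ((γ 1 1 : ℤ) : ℚ)) = (A : ℚ) / (ℓ * C') := by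
    rw [hnum, hden, div_div]
  rw [hquot] at key
  rw [key, add_sub_cancel_right]
  exact cuspSymbol_mem_periodLattice f _

/-! ## §2 Lattice differences of modular symbols are half-integer differences of rational plus symbols -/

/-- **`{∞, x} − {∞, y} ∈ Λ_f ⟹ [x]⁺_f − [y]⁺_f ∈ ½ℤ` (normalised symbols, real coefficients)**: `re Λ_f = ℤ·Ω⁺_f/2` and
`[·]⁺ = re{∞, ·}/Ω⁺_f` (`plusSymbol_eq_re_holds`); junk case `Ω⁺_f = 0`: both symbols vanish. The two-cusp form of the tree's
`exists_normalizedPlusSymbol_sub_inv_eq_div_two`. [cite: CremonaAlgorithms1997, §2.8] [cite: MazurTateTeitelbaum1986Invent, §I.8] -/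
theorem exists_normalizedPlusSymbol_sub_eq_div_two_of_sub_mem (hreal : ∀ n, (cuspCoeff f n).im = 0) {x y : ℚ}
    (h : modularSymbol f x - modularSymbol f y ∈ periodLattice f) :
    ∃ k : ℤ, normalizedPlusSymbol f x - normalizedPlusSymbol f y = (k : ℝ) / 2 := by
  by_cases hΩ : plusPeriod f = 0
  · refine ⟨0, ?_⟩
    rw [normalizedPlusSymbol_eq_zero_of_plusPeriod_eq_zero f hΩ,
      normalizedPlusSymbol_eq_zero_of_plusPeriod_eq_zero f hΩ]
    simp
  obtain ⟨hre, hpos⟩ := realPeriods_eq_zmultiples_of_plusPeriod_ne_zero f hΩ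
  obtain ⟨k, hk⟩ := exists_re_eq_add_of_sub_mem f hre h
  refine ⟨k, ?_⟩
  rw [normalizedPlusSymbol, normalizedPlusSymbol, plusSymbol_eq_re_holds f hreal x,
    plusSymbol_eq_re_holds f hreal y, Complex.ofReal_re, Complex.ofReal_re, hk]
  field_simp
  ring

/-- **`{∞, x} − {∞, y} ∈ Λ_f ⟹ ratPlusSymbol f x = ratPlusSymbol f y + k/2`, `k ∈ ℤ`** (junk-safe: if `[y]⁺ ∉ ℚ` then
`[x]⁺ ∉ ℚ` and both sides are `0`). The two-cusp form of the tree's `exists_ratPlusSymbol_eq_inv_add_div_two`.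
[cite: MazurTateTeitelbaum1986Invent, §I.8] -/
theorem exists_ratPlusSymbol_eq_add_div_two_of_sub_mem (hreal : ∀ n, (cuspCoeff f n).im = 0) {x y : ℚ}
    (h : modularSymbol f x - modularSymbol f y ∈ periodLattice f) :
    ∃ k : ℤ, ratPlusSymbol f x = ratPlusSymbol f y + (k : ℚ) / 2 := by
  obtain ⟨k, hk⟩ := exists_normalizedPlusSymbol_sub_eq_div_two_of_sub_mem f hreal h
  by_cases h0 : ∃ q : ℚ, (q : ℝ) = normalizedPlusSymbol f y
  · have hx' : ∃ q : ℚ, (q : ℝ) = normalizedPlusSymbol f x := by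
      obtain ⟨q, hq⟩ := h0
      exact ⟨q + (k : ℚ) / 2, by push_cast; rw [hq]; linarith⟩
    refine ⟨k, ?_⟩
    unfold ratPlusSymbol
    rw [dif_pos hx', dif_pos h0]
    apply Rat.cast_injective (α := ℝ)
    push_cast
    rw [hx'.choose_spec, h0.choose_spec]
    linarith
  · have hx' : ¬ ∃ q : ℚ, (q : ℝ) = normalizedPlusSymbol f x := by
      rintro ⟨q, hq⟩
      exact h0 ⟨q - (k : ℚ) / 2, by push_cast; rw [hq]; linarith⟩
    refine ⟨0, ?_⟩
    unfold ratPlusSymbol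
    rw [dif_neg hx', dif_neg h0]
    simp

/-! ## §3 The `U_ℓ`-relation with `a_ℓ = 0` -/

/-- Fractions `a/ℓ`, `b/ℓ` with `a ≡ b (mod ℓ)` have the same rational plus symbol (`[r + k]⁺ = [r]⁺`). [folklore] -/
theorem ratPlusSymbol_div_eq_of_dvd_sub {ℓ : ℤ} (hℓ : ℓ ≠ 0) {a b : ℤ} (h : ℓ ∣ a - b) :
    ratPlusSymbol f ((a : ℚ) / ℓ) = ratPlusSymbol f ((b : ℚ) / ℓ) := by
  obtain ⟨k, hk⟩ := h
  have hℓQ : (ℓ : ℚ) ≠ 0 := by exact_mod_cast hℓ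
  have hab : (a : ℚ) / ℓ = (b : ℚ) / ℓ + (k : ℤ) := by
    have : (a : ℚ) = b + ℓ * k := by exact_mod_cast (by linear_combination hk : a = b + ℓ * k)
    rw [this]; field_simp
  rw [hab, ratPlusSymbol_add_intCast_eq]

/-- **`Σ_{j mod ℓ} [(x + j)/ℓ]⁺_f = 0` for a rational newform with `a_ℓ(f) = 0`, `ℓ ∣ N`** (the `U_ℓ`-relation
`a_ℓ[x]⁺ = Σ_j [(x+j)/ℓ]⁺`, `intCast_mul_ratPlusSymbol_of_dvd`, with `a_ℓ = 0`: the case of a prime of ADDITIVE reduction).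
[cite: MazurTateTeitelbaum1986Invent, §I.4 (4.2)] -/
theorem sum_ratPlusSymbol_add_div_eq_zero {f : CuspForm (Gamma0 N) 2} (hf : IsNewform0 f) (hQ : coeffField f = ⊥)
    {ℓ : ℕ} (hℓ : ℓ.Prime) (hℓN : ℓ ∣ N) (ha : cuspCoeff f ℓ = 0) (x : ℚ) :
    ∑ j : Fin ℓ, ratPlusSymbol f ((x + j) / ℓ) = 0 := by
  haveI : NeZero ℓ := ⟨hℓ.ne_zero⟩
  haveI : Fact ℓ.Prime := ⟨hℓ⟩
  have h := intCast_mul_ratPlusSymbol_of_dvd (p := ℓ) hf hℓ hℓN (ap := 0) (by rw [ha, Int.cast_zero])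
    (ratCast_ratPlusSymbol_holds hf hQ) x
  rw [Int.cast_zero, zero_mul] at h
  exact h.symm

/-- A sum over `ZMod ℓ` of a function of `val` is the corresponding sum over `Fin ℓ` (`ℓ ≠ 0`). [folklore] -/
theorem sum_zmod_val_eq_sum_fin {ℓ : ℕ} [NeZero ℓ] {R : Type*} [AddCommMonoid R] (g : ℕ → R) :
    ∑ c : ZMod ℓ, g c.val = ∑ j : Fin ℓ, g j.val := by
  obtain ⟨k, hk⟩ := Nat.exists_eq_succ_of_ne_zero (NeZero.ne ℓ)
  subst hk
  rfl

/-- **`Σ_{c mod ℓ} [c·t/ℓ]⁺_f = 0`** for `t` prime to `ℓ` and a rational newform with `a_ℓ = 0`, `ℓ ∣ N` (reindex `c ↦ c·t` in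
`Σ_{c} [c/ℓ]⁺ = Σ_{j mod ℓ} [(0 + j)/ℓ]⁺ = a_ℓ[0]⁺ = 0`). [cite: MazurTateTeitelbaum1986Invent, §I.4 (4.2)] -/
theorem sum_ratPlusSymbol_val_mul_div_eq_zero {f : CuspForm (Gamma0 N) 2} (hf : IsNewform0 f) (hQ : coeffField f = ⊥)
    {ℓ : ℕ} [NeZero ℓ] (hℓ : ℓ.Prime) (hℓN : ℓ ∣ N) (ha : cuspCoeff f ℓ = 0) {t : ℤ} (ht : ¬ (ℓ : ℤ) ∣ t) :
    ∑ c : ZMod ℓ, ratPlusSymbol f (((c.val : ℤ) * t : ℤ) / (ℓ : ℚ)) = 0 := by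
  haveI : Fact ℓ.Prime := ⟨hℓ⟩
  have hℓ0 : (ℓ : ℤ) ≠ 0 := by exact_mod_cast hℓ.ne_zero
  have ht0 : (t : ZMod ℓ) ≠ 0 := by rwa [Ne, ZMod.intCast_zmod_eq_zero_iff_dvd]
  -- reindex `c ↦ c·t`
  have hre : ∑ c : ZMod ℓ, ratPlusSymbol f (((c.val : ℤ) * t : ℤ) / (ℓ : ℚ)) =
      ∑ c : ZMod ℓ, ratPlusSymbol f (((c.val : ℤ) : ℤ) / (ℓ : ℚ)) := by
    refine Fintype.sum_equiv (Equiv.mulRight₀ (t : ZMod ℓ) ht0) _ _ fun c ↦ ?_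
    rw [Equiv.mulRight₀_apply]
    have hcast : ((ℓ : ℚ)) = ((ℓ : ℤ) : ℚ) := by norm_cast
    rw [hcast]
    refine ratPlusSymbol_div_eq_of_dvd_sub f hℓ0 ?_
    rw [← ZMod.intCast_zmod_eq_zero_iff_dvd]
    push_cast
    rw [ZMod.natCast_zmod_val, ZMod.natCast_zmod_val]
    ring
  rw [hre]
  have h0 := sum_ratPlusSymbol_add_div_eq_zero hf hQ hℓ hℓN ha 0
  simp only [zero_add] at h0
  rw [← h0, sum_zmod_val_eq_sum_fin (fun v : ℕ ↦ ratPlusSymbol f (((v : ℤ) : ℤ) / (ℓ : ℚ)))]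
  refine Finset.sum_congr rfl fun j _ ↦ ?_
  push_cast
  rfl

/-- **`Σ_{c mod ℓ, c ≠ 0} [c·t/ℓ]⁺_f = −[0]⁺_f`** under the same hypotheses (the `c = 0` term of the previous sum is `[0]⁺`).
[cite: MazurTateTeitelbaum1986Invent, §I.4 (4.2)] -/
theorem sum_erase_ratPlusSymbol_val_mul_div_eq_neg {f : CuspForm (Gamma0 N) 2} (hf : IsNewform0 f) (hQ : coeffField f = ⊥)
    {ℓ : ℕ} [NeZero ℓ] (hℓ : ℓ.Prime) (hℓN : ℓ ∣ N) (ha : cuspCoeff f ℓ = 0) {t : ℤ} (ht : ¬ (ℓ : ℤ) ∣ t) :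
    ∑ c ∈ (Finset.univ : Finset (ZMod ℓ)).erase 0, ratPlusSymbol f (((c.val : ℤ) * t : ℤ) / (ℓ : ℚ)) =
      -ratPlusSymbol f 0 := by
  have h := sum_ratPlusSymbol_val_mul_div_eq_zero hf hQ hℓ hℓN ha ht
  rw [← Finset.add_sum_erase _ _ (Finset.mem_univ (0 : ZMod ℓ)), ZMod.val_zero] at h
  simp only [Nat.cast_zero, zero_mul, Int.cast_zero, zero_div] at h
  linear_combination h

/-! ## §4 The shift lemma: character sums of class functions vanish -/

/-- **Shift lemma**: if `F(b·h₀) = F(b)` for all `b` and `χ(h₀) ≠ 1` for a unit `h₀`, then `Σ_b χ(b)·F(b) = 0` (reindex `b ↦ b·h₀`: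
the sum equals `χ(h₀)` times itself). Used with `h₀ ≡ 1 (mod ℓ)`: the class representatives `[c(b)/ℓ]⁺`, which depend on `b mod ℓ`
only, cancel in the `χ`-isotypic sums as soon as `χ` is non-trivial on the units `≡ 1 (mod ℓ)`. [folklore] -/
theorem sum_mul_eq_zero_of_shift {u : ℕ} [NeZero u] {K : Type*} [Field K] (χ : MulChar (ZMod u) K) (F : ZMod u → K)
    (h₀ : (ZMod u)ˣ) (hF : ∀ b : ZMod u, F (b * h₀) = F b) (hχ : χ h₀ ≠ 1) :
    ∑ b : ZMod u, χ b * F b = 0 := by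
  set S := ∑ b : ZMod u, χ b * F b with hS
  have hreindex : S = χ h₀ * S := by
    rw [hS, Finset.mul_sum]
    refine (Fintype.sum_equiv (Units.mulRight h₀) _ _ fun b ↦ ?_).symm
    show χ h₀ * (χ b * F b) = χ (b * h₀) * F (b * h₀)
    rw [map_mul, hF]; ring
  have h1 : (χ h₀ - 1) * S = 0 := by linear_combination -hreindex
  rcases mul_eq_zero.mp h1 with h | h
  · exact absurd (sub_eq_zero.mp h) hχ
  · exact h

end Summit.BirchSwinnertonDyer.BirchSwinnertonDyer.Theorems.AlignedTransportAtTwoBothAddSymbol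

end
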